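import Summits.BirchSwinnertonDyer.BirchSwinnertonDyer.Theses.SignedLowerHalves
import HarnessLib

/-!
# Route `SignedLowerHalves`, support item `PublishedSignedInputsOfParts` (stmt-BirchSwinnertonDyer-19292):
# the split glue «ten cite-only children ⟹ the parent `PublishedSignedInputs`» (cell `bsd-ssimc`, seat
# `bsd-ssimc-k3-c2` gen 2; planner g13 STAFFABLE line 2026-08-26T03:52Z, sketch `K3-route/staffable-v1/AliasSketch.lean`)

PARTITION (cell bsd-ssimc): none of A6 / A7 / A8 / D1 / D2 — route bookkeeping only (the support item's
split glue); types-the-object-of nothing; closes item stmt-BirchSwinnertonDyer-19292 only. HONEST FRAMING: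
this is pure logic — the parent `PublishedSignedInputs` is the conjunction, in conjunct order, of the ten
PUBLISHED named facts its children state BY NAME (Wuthrich 2014 Prop. 21, Kobayashi 2003 Thm. 1.2 / Thm. 4.1,
B. D. Kim 2013 Cor. 3.15, Burungale–Kobayashi–Ota 2024 Cor. A.5, the two period relations, modularity,
entireness of `L(E,s)`, Gross–Zagier–Kolyvagin), so the glue is the anonymous constructor. Nothing about any
curve is asserted and no cite-only fact is proved here; BSD is not proved by any of this.
-/

set_option autoImplicit false
set_option linter.dupNamespace false

namespace Summit.BirchSwinnertonDyer.BirchSwinnertonDyer.Theorems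

/-- **The split glue of the support item `PublishedSignedInputs`** (route `SignedLowerHalves`, item
stmt-BirchSwinnertonDyer-19292): the ten children `WuthrichShaDividesAnalyticSha`, …, `RankEqAnalyticRankLeOne`
are the ten conjuncts of the parent BY NAME and in order, so `C1 → … → C10 → PublishedSignedInputs` is the
anonymous constructor. Pure logic; no published fact is proved here. [folklore] -/
theorem publishedSignedInputsOfParts_holds :
    Summit.BirchSwinnertonDyer.BirchSwinnertonDyer.Theses.SignedLowerHalves.PublishedSignedInputsOfParts :=
  fun h1 h2 h3 h4 h5 h6 h7 h8 h9 h10 => ⟨h1, h2, h3, h4, h5, h6, h7, h8, h9, h10⟩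

end Summit.BirchSwinnertonDyer.BirchSwinnertonDyer.Theorems
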